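import Mathlib
import Summits.Parity.GeneralizedHardyLittlewood.Theorems.FordMaynardSieveConst01651SieveConst01651TypeIIBilin
import Summits.Parity.GeneralizedHardyLittlewood.Theorems.FordMaynardSieveConst01651SieveConst01651TupleLift
import Summits.Parity.GeneralizedHardyLittlewood.Theorems.FordMaynardSieveConst01651SieveConst01651ShellSeparation

/-!
# Route `FordMaynardSieveConst01651`, target `SieveConst01651` (stmt-Parity-19185), line `sieve_decomposition`:
# helpers towards `stub_typeIIRegion` — the Type-II kernel as a REAL kernel bounded below (plumbing for
# `…ShellSeparation.bilin_threshold_of_neg_le`)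

`bilin_threshold_of_neg_le` / `bilin_shell_abs_sum_le` (Ford–Maynard Lemma 7.10 in `BilinBoundedBy` form) want a
real kernel `k` with `-M ≤ k`, `0 ≤ M` on `W × Z`.  Here the kernels delivered by (II) — the integer kernel
`τ(m)^{B'} τ(n)^{B'} 𝟙[x/2 < mn ≤ x] w(mn)` and its tuple lift `τ(m)^{B'} 𝟙[x/2 < m ∏t ≤ x] w(m ∏t)` — are put in
exactly that shape, with `M = τ(m)^{B'} (τ(n)^{B'}) x^{ν/10}` from the second half of (w), `w_n ≥ -x^{ν/10}`.

* `bilinBoundedBy_of_typeII_real` — (II) ⇒ `BilinBoundedBy (↑k) W Z (x/(log x)^B)` for the real integer kernel.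
* `bilinBoundedBy_of_typeII_tuple_real` — the same for the tuple-lifted real kernel (`B' ≥ l - 1`).
* `typeII_kernel_neg_le`, `typeII_tupleKernel_neg_le` — the lower bounds `-M ≤ k` (and `0 ≤ M`).

Def-free. Nothing here proves anything about the Parity summit; helpers for the Type-II region stub of one leaf.
-/

open Finset Literature.NumberTheory.Sieve.FriedlanderIwaniecPrimes

namespace Summit.Parity.GeneralizedHardyLittlewood.FordMaynardSieveConst01651SieveConst01651

/-- **(II) as a bound for a REAL kernel**: `k(m,n) = τ(m)^{B'} τ(n)^{B'} 𝟙[x/2 < mn ≤ x] w(mn)` (`B' ≤ B`).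
[cite: FordMaynard2024PrimeSieves, §1 (II)] -/
theorem bilinBoundedBy_of_typeII_real {w : ℕ → ℝ} {x θ ν B : ℝ}
    (hII : Literature.Barriers.Parity.FordMaynard.TypeII w x θ ν B) {B' : ℝ} (hB'B : B' ≤ B) :
    BilinBoundedBy
      (fun m n : ℕ => (((m.divisors.card : ℝ) ^ B' * (n.divisors.card : ℝ) ^ B' *
        (if x / 2 < (m * n : ℝ) ∧ (m * n : ℝ) ≤ x then w (m * n) else 0) : ℝ) : ℂ))
      ((Icc 1 ⌊x ^ (θ + ν)⌋₊).filter (fun m : ℕ => (x / 2) ^ θ < (m : ℝ))) (Icc 1 ⌊x⌋₊)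
      (x / Real.log x ^ B) := by
  refine (bilinBoundedBy_of_typeII hII hB'B).congr fun m _ n _ => ?_
  split_ifs <;> push_cast <;> ring

/-- **(II) as a bound for the tuple-lifted REAL kernel**:
`k(m,t) = τ(m)^{B'} 𝟙[x/2 < m ∏t ≤ x] w(m ∏t)` on `W × {t : ∏ t ∈ [1, x]}` (`l - 1 ≤ B' ≤ B`, `B' ≥ 0`).
[cite: FordMaynard2024PrimeSieves, §1 (II) and Lemma 7.7] -/
theorem bilinBoundedBy_of_typeII_tuple_real {w : ℕ → ℝ} {x θ ν B : ℝ}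
    (hII : Literature.Barriers.Parity.FordMaynard.TypeII w x θ ν B) {B' : ℝ} (hB'0 : 0 ≤ B') (hB'B : B' ≤ B)
    {l : ℕ} (hl : (l : ℝ) - 1 ≤ B') :
    BilinBoundedBy
      (fun (m : ℕ) (t : Fin l → ℕ) => (((m.divisors.card : ℝ) ^ B' *
        (if x / 2 < (m * (∏ i, t i : ℕ) : ℝ) ∧ (m * (∏ i, t i : ℕ) : ℝ) ≤ x then w (m * ∏ i, t i) else 0) : ℝ) : ℂ))
      ((Icc 1 ⌊x ^ (θ + ν)⌋₊).filter (fun m : ℕ => (x / 2) ^ θ < (m : ℝ)))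
      ((Icc 1 ⌊x⌋₊).biUnion fun n => Nat.finMulAntidiag l n)
      (x / Real.log x ^ B) := by
  have h := bilin_tupleLift' (bilinBoundedBy_of_typeII hII hB'B) hB'0 hl
  refine h.congr fun m _ t _ => ?_
  push_cast
  split_ifs <;> push_cast <;> ring

/-- The lower bound of the integer kernel from the second half of (w): if `-X₀ ≤ w(n)` for all `n` (`X₀ ≥ 0`),
then `-(τ(m)^{B'} τ(n)^{B'} X₀) ≤ k(m,n)` and `0 ≤ τ(m)^{B'} τ(n)^{B'} X₀`.
[cite: FordMaynard2024PrimeSieves, §2 (w) (second half) and Lemma 7.10] -/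
theorem typeII_kernel_neg_le {w : ℕ → ℝ} {x X₀ B' : ℝ} (hX₀ : 0 ≤ X₀) (hw : ∀ n, -X₀ ≤ w n) (m n : ℕ) :
    0 ≤ (m.divisors.card : ℝ) ^ B' * (n.divisors.card : ℝ) ^ B' * X₀ ∧
      -((m.divisors.card : ℝ) ^ B' * (n.divisors.card : ℝ) ^ B' * X₀) ≤
        (m.divisors.card : ℝ) ^ B' * (n.divisors.card : ℝ) ^ B' *
          (if x / 2 < (m * n : ℝ) ∧ (m * n : ℝ) ≤ x then w (m * n) else 0) := by
  have hτ : 0 ≤ (m.divisors.card : ℝ) ^ B' * (n.divisors.card : ℝ) ^ B' :=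
    mul_nonneg (Real.rpow_nonneg (Nat.cast_nonneg _) _) (Real.rpow_nonneg (Nat.cast_nonneg _) _)
  refine ⟨mul_nonneg hτ hX₀, ?_⟩
  rw [← mul_neg]
  refine mul_le_mul_of_nonneg_left ?_ hτ
  split_ifs
  · exact hw _
  · linarith

/-- The lower bound of the tuple-lifted kernel: `-(τ(m)^{B'} X₀) ≤ k(m,t)`, `0 ≤ τ(m)^{B'} X₀`.
[cite: FordMaynard2024PrimeSieves, §2 (w) (second half) and Lemma 7.10] -/
theorem typeII_tupleKernel_neg_le {w : ℕ → ℝ} {x X₀ B' : ℝ} (hX₀ : 0 ≤ X₀) (hw : ∀ n, -X₀ ≤ w n) {l : ℕ}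
    (m : ℕ) (t : Fin l → ℕ) :
    0 ≤ (m.divisors.card : ℝ) ^ B' * X₀ ∧
      -((m.divisors.card : ℝ) ^ B' * X₀) ≤ (m.divisors.card : ℝ) ^ B' *
        (if x / 2 < (m * (∏ i, t i : ℕ) : ℝ) ∧ (m * (∏ i, t i : ℕ) : ℝ) ≤ x then w (m * ∏ i, t i) else 0) := by
  have hτ : 0 ≤ (m.divisors.card : ℝ) ^ B' := Real.rpow_nonneg (Nat.cast_nonneg _) _
  refine ⟨mul_nonneg hτ hX₀, ?_⟩
  rw [← mul_neg]
  refine mul_le_mul_of_nonneg_left ?_ hτ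
  split_ifs
  · exact hw _
  · linarith

/-- **Ford–Maynard Lemma 7.10 for the Type-II tuple kernel, fully instantiated**: under (II) (exponent `B`,
`0 ≤ l - 1 ≤ B' ≤ B`) and `w ≥ -X₀`, for any real functions `A` (of the tuple) and `Bf` (of the short variable) with
`|A t - Bf m| ≤ R` (`R ≥ 1`), every bilinear form in `[Bf m < A t] · k(m,t)` with `1`-bounded coefficients is at most
`(3(1 + log R) + 3) · x/(log x)^B + 2 X₀ ∑_{|A t - Bf m| ≤ 3/R} τ(m)^{B'}`.
[cite: FordMaynard2024PrimeSieves, Lemma 7.10] -/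
theorem typeII_tuple_threshold {w : ℕ → ℝ} {x θ ν B : ℝ}
    (hII : Literature.Barriers.Parity.FordMaynard.TypeII w x θ ν B) {B' : ℝ} (hB'0 : 0 ≤ B') (hB'B : B' ≤ B)
    {l : ℕ} (hl : (l : ℝ) - 1 ≤ B') {X₀ : ℝ} (hX₀ : 0 ≤ X₀) (hw : ∀ n, -X₀ ≤ w n)
    {A : (Fin l → ℕ) → ℝ} {Bf : ℕ → ℝ} {R : ℝ} (hR : 1 ≤ R)
    (hsize : ∀ m ∈ (Icc 1 ⌊x ^ (θ + ν)⌋₊).filter (fun m : ℕ => (x / 2) ^ θ < (m : ℝ)),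
      ∀ t ∈ (Icc 1 ⌊x⌋₊).biUnion (fun n => Nat.finMulAntidiag l n), |A t - Bf m| ≤ R) :
    BilinBoundedBy
      (fun (m : ℕ) (t : Fin l → ℕ) => (if Bf m < A t then (1 : ℂ) else 0) *
        (((m.divisors.card : ℝ) ^ B' *
          (if x / 2 < (m * (∏ i, t i : ℕ) : ℝ) ∧ (m * (∏ i, t i : ℕ) : ℝ) ≤ x then w (m * ∏ i, t i) else 0) : ℝ) : ℂ))
      ((Icc 1 ⌊x ^ (θ + ν)⌋₊).filter (fun m : ℕ => (x / 2) ^ θ < (m : ℝ)))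
      ((Icc 1 ⌊x⌋₊).biUnion fun n => Nat.finMulAntidiag l n)
      ((3 * (1 + Real.log R) + 3) * (x / Real.log x ^ B) +
        2 * ∑ m ∈ (Icc 1 ⌊x ^ (θ + ν)⌋₊).filter (fun m : ℕ => (x / 2) ^ θ < (m : ℝ)),
          ∑ t ∈ (Icc 1 ⌊x⌋₊).biUnion (fun n => Nat.finMulAntidiag l n),
            if |A t - Bf m| ≤ 3 / R then (m.divisors.card : ℝ) ^ B' * X₀ else 0) := by
  have h := bilinBoundedBy_of_typeII_tuple_real hII hB'0 hB'B hl
  have hM0 : ∀ m ∈ (Icc 1 ⌊x ^ (θ + ν)⌋₊).filter (fun m : ℕ => (x / 2) ^ θ < (m : ℝ)),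
      ∀ t ∈ (Icc 1 ⌊x⌋₊).biUnion (fun n => Nat.finMulAntidiag l n),
        0 ≤ (fun (m : ℕ) (_ : Fin l → ℕ) => (m.divisors.card : ℝ) ^ B' * X₀) m t :=
    fun m _ t _ => (typeII_tupleKernel_neg_le (x := x) (B' := B') hX₀ hw m t).1
  have hkM : ∀ m ∈ (Icc 1 ⌊x ^ (θ + ν)⌋₊).filter (fun m : ℕ => (x / 2) ^ θ < (m : ℝ)),
      ∀ t ∈ (Icc 1 ⌊x⌋₊).biUnion (fun n => Nat.finMulAntidiag l n),
        -((fun (m : ℕ) (_ : Fin l → ℕ) => (m.divisors.card : ℝ) ^ B' * X₀) m t) ≤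
          (fun (m : ℕ) (t : Fin l → ℕ) => (m.divisors.card : ℝ) ^ B' *
            (if x / 2 < (m * (∏ i, t i : ℕ) : ℝ) ∧ (m * (∏ i, t i : ℕ) : ℝ) ≤ x then w (m * ∏ i, t i) else 0))
            m t :=
    fun m _ t _ => (typeII_tupleKernel_neg_le (x := x) (B' := B') hX₀ hw m t).2
  exact bilin_threshold_of_neg_le h hM0 hkM hR hsize

end Summit.Parity.GeneralizedHardyLittlewood.FordMaynardSieveConst01651SieveConst01651
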